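import Summits.HodgeConjecture.CorCM.MumfordTateRankTypeTwoLefschetz
import Literature.LinearAlgebra.QuadraticForm.TraceFormDescent
import Literature.Algebra.Lie.QuaternionCentralizerSkewDimensionForm
import HarnessLib

/-!
# Lefschetz bounds over a totally real centre: `dim Lie Hg(H¹B) ≤ e · m(2m−1)` for type III(e) and `≤ e · m(2m+1)` for
# type II(e) (`End⁰B` a quaternion algebra over a totally real field `K` of degree `e`, `dim B = 2em`)

COR-CM (cell `pub-hodgecm2`, seat `b27` gen 45, count-neutral Mumford–Tate-rank ladder; theorems only, no definition, no named
fact; UNCONDITIONAL — nothing here uses or asserts HC_CM).  The general-centre form of `CorCM/MumfordTateRankTypeThreeLefschetz` §3 and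
`CorCM/MumfordTateRankTypeTwoLefschetz` §3 (`K = ℚ`), i.e. Milne's Lefschetz dimensions `g²/2f ∓ g/2` (`f = e = [K : ℚ]`,
`g = 2em`), bounding the Hodge Lie algebra from above (Moonen–Zarhin §1 «`Hg(X) ⊂ Sp_D(V, φ)`»).

METHOD.  With the `K`-algebra structure on `End⁰B` (`[Algebra K End⁰B]`, `[IsQuaternionAlgebra K End⁰B]`, as in
`HodgeTheory/QuaternionMinimalPowersHodgeClasses`), `H¹(B, ℚ)` is a `K`-space through `bettiRep`; Rosati fixes the centre (no type
IV), so `ψ` is `K`-balanced and descends, `ψ(a x, y) = Tr_{K/ℚ}(a · ψ_K(x, y))` (`LinearAlgebra/QuadraticForm/TraceFormDescent`); a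
quaternion basis `i, j` over `K` acts `K`-linearly with the Rosati signs, `Lie Hg(H¹B)` embeds `ℚ`-linearly into the `K`-space
`C_K(i, j) ∩ 𝔰𝔭(ψ_K)` of `K`-dimension `n(n∓2)/8`, `n = 4m` (`Algebra/Lie/QuaternionCentralizerSkewDimensionForm`), and `dim_ℚ = e · dim_K`.

* `exists_finrank_hodgeLie_le_of_centre_pair` — the engine for a Rosati pair `u† = -u`, `v† = ∓v` in `End⁰B` over `K`.
* **`finrank_hodgeLie_hodge_one_le_of_isTotallyDefinite_centre`**, `mtRank_hodge_one_le_of_isTotallyDefinite_centre` — type III(e):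
  `dim Lie Hg(H¹B) ≤ e · m(2m−1)`, `dim MT(H¹B) ≤ e · m(2m−1) + 1`.
* **`finrank_hodgeLie_hodge_one_le_of_isTotallyIndefinite_centre`**, `mtRank_hodge_one_le_of_isTotallyIndefinite_centre` — type
  II(e): `dim Lie Hg(H¹B) ≤ e · m(2m+1)`, `dim MT(H¹B) ≤ e · m(2m+1) + 1`.

## References
* [Milne1999LefschetzClasses] J. S. Milne, Duke Math. J. 96 (1999), §2 (types II, III; `ψ` from an `F`-form by the trace) and
  Summary (`dim S(A) = g²/2f ∓ g/2`).
* [MoonenZarhin1999LowDim] B. Moonen, Yu. Zarhin, Math. Ann. 315 (1999), §1 (`Hg(X) ⊂ Sp_D(V, φ)`).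
* [Lange2023AbelianVarietiesComplex] H. Lange, *Abelian Varieties over the Complex Numbers* (2023), §2.6.2 Thm. 2.6.5 (b), (c).
-/

noncomputable section

open scoped TensorProduct Quaternion
open CategoryTheory CategoryTheory.Limits Module NumberField

namespace Summit.HodgeConjecture.CorCM

open Literature.AlgebraicGeometry.Motives
open Literature.AlgebraicGeometry.Motives.AbelianVariety
open Literature.AlgebraicGeometry.Motives.HodgeStructure
open Literature.AlgebraicGeometry.HodgeTheory
open Literature.AlgebraicGeometry.ComplexMultiplication (bettiRep bettiRep_injective)
open Literature.NumberTheory.Automorphic (IsQuaternionAlgebra IsTotallyDefinite standardInvolution standardInvolution_algEquiv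
  standardInvolution_quaternionAlgebra)
open Literature.RingTheory.CentralSimple
open Literature.Algebra.Lie
open Literature.LinearAlgebra.QuadraticForm

variable [HodgeTensorFacts.{0, 0}]

/-! ## §1 The engine: a Rosati pair over the centre `K` bounds `dim Lie Hg(H¹B)` by `e · dim_K (C_K(i, j) ∩ 𝔰𝔭(ψ_K))` -/

/-- **The general-centre Lefschetz engine.**  Let `End⁰B` be a quaternion algebra over a totally real number field `K` (`K`-algebra
structure compatible with `ℚ`), `ψ` a polarization of `H¹B`, and `u, v ∈ End⁰B` with `u² = a`, `v² = b` (`a, b ∈ K×`), `uv = -vu`,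
`u^ros = -u`.  Then there are `n, M ∈ ℕ` with `e · n = dim_ℚ H¹B` (`n = dim_K H¹B`), `dim Lie Hg(H¹B) ≤ e · M`, and
`8M + 2n = n²` if `v^ros = -v` (type III), `8M = n² + 2n` if `v^ros = v` (type II): `H¹B` is a `K`-space through `bettiRep`,
`ψ = Tr_{K/ℚ} ∘ ψ_K` (Rosati fixes the centre), `Lie Hg ↪ C_K(i, j) ∩ 𝔰𝔭(ψ_K)` and `M` is the `K`-dimension of the latter.
[cite: Milne1999LefschetzClasses, §2 and Summary] [cite: MoonenZarhin1999LowDim, §1] -/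
theorem exists_finrank_hodgeLie_le_of_centre_pair {B : AbelianVariety ℂ} {K : Type} [Field K] [NumberField K] [IsTotallyReal K]
    [Algebra K B.endAlgebra] [IsScalarTower ℚ K B.endAlgebra] [IsQuaternionAlgebra K B.endAlgebra]
    [Module.Finite ℚ (bettiCohomology B.X 1)]
    (ψ : (BettiUniverse.hodge exists_isReal_hodgeModel_holds (AbelianVariety.isSmoothProjective_holds (A := B)) 1).Polarization)
    {u v : B.endAlgebra} {a b : K} (ha : a ≠ 0) (hb : b ≠ 0) (hu : u * u = algebraMap K _ a) (hv : v * v = algebraMap K _ b)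
    (huv : u * v = -(v * u))
    (hru : AbelianVariety.rosati B exists_isReal_hodgeModel_holds hodgePQ_independent_of_hodgeModel_holds ψ u = -u) :
    ∃ n M : ℕ, Module.finrank ℚ K * n = Module.finrank ℚ (bettiCohomology B.X 1) ∧
      Module.finrank ℚ
          (BettiUniverse.hodge exists_isReal_hodgeModel_holds (AbelianVariety.isSmoothProjective_holds (A := B)) 1).hodgeLie ≤
        Module.finrank ℚ K * M ∧
      (AbelianVariety.rosati B exists_isReal_hodgeModel_holds hodgePQ_independent_of_hodgeModel_holds ψ v = -v →
        8 * M + 2 * n = n * n) ∧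
      (AbelianVariety.rosati B exists_isReal_hodgeModel_holds hodgePQ_independent_of_hodgeModel_holds ψ v = v →
        8 * M = n * n + 2 * n) := by
  classical
  have hHD : exists_isReal_hodgeModel := exists_isReal_hodgeModel_holds
  have hI : hodgePQ_independent_of_hodgeModel := hodgePQ_independent_of_hodgeModel_holds
  have hX : IsSmoothProjective B.dim B.X := AbelianVariety.isSmoothProjective_holds
  have hA4 : HasNoTypeIVFactor B := AbelianVariety.hasNoTypeIVFactor_of_isTotallyReal (K := K)
  -- `ρ = unop ∘ bettiRep`, Riemann's anti-isomorphism onto `End_Hdg(H¹B)`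
  let ρ : B.endAlgebra → Module.End ℚ (bettiCohomology B.X 1) := fun z => MulOpposite.unop (bettiRep B z)
  have hρ : ∀ z, ρ z = MulOpposite.unop (bettiRep B z) := fun z => rfl
  have hρmul : ∀ z w, ρ (z * w) = ρ w * ρ z := fun z w => by rw [hρ, hρ, hρ, map_mul, MulOpposite.unop_mul]
  have hρadd : ∀ z w, ρ (z + w) = ρ z + ρ w := fun z w => by rw [hρ, hρ, hρ, map_add, MulOpposite.unop_add]
  have hρneg : ∀ z, ρ (-z) = -ρ z := fun z => by rw [hρ, hρ, map_neg, MulOpposite.unop_neg]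
  have hρzero : ρ 0 = 0 := by rw [hρ, map_zero, MulOpposite.unop_zero]
  have hρone : ρ 1 = 1 := by rw [hρ, map_one, MulOpposite.unop_one]
  have hρrat : ∀ r : ℚ, ρ (algebraMap ℚ B.endAlgebra r) = r • (1 : Module.End ℚ (bettiCohomology B.X 1)) := fun r => by
    rw [hρ, AlgHom.commutes, MulOpposite.algebraMap_apply, MulOpposite.unop_op, Algebra.algebraMap_eq_smul_one]
  have hρA : ∀ z, ρ z ∈ (BettiUniverse.hodge exists_isReal_hodgeModel_holds (AbelianVariety.isSmoothProjective_holds (A := B)) 1).endAlg := fun z =>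
    Literature.AlgebraicGeometry.ComplexMultiplication.unop_bettiRep_mem_endAlg hHD hI z
  have hτρ : ∀ z, ψ.adjoint (ρ z) =
      ρ (AbelianVariety.rosati B exists_isReal_hodgeModel_holds hodgePQ_independent_of_hodgeModel_holds ψ z) :=
    fun z => (AbelianVariety.unop_bettiRep_rosati hHD hI ψ z).symm
  have hcomm_hodge : ∀ {Y : Module.End ℚ (bettiCohomology B.X 1)}, Y ∈ (BettiUniverse.hodge exists_isReal_hodgeModel_holds (AbelianVariety.isSmoothProjective_holds (A := B)) 1).hodgeLie →
      ∀ z, Y * ρ z = ρ z * Y := fun hY z => commute_of_mem_hodgeLie _ hY ⟨_, hρA z⟩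
  -- the centre `K` acts by Rosati-fixed endomorphisms commuting with `ρ(End⁰B)`
  have hcenK : ∀ (c : K) (z : B.endAlgebra), ρ (algebraMap K _ c) * ρ z = ρ z * ρ (algebraMap K _ c) := fun c z => by
    rw [← hρmul, ← hρmul, Algebra.commutes]
  have hrosK : ∀ c : K, AbelianVariety.rosati B exists_isReal_hodgeModel_holds hodgePQ_independent_of_hodgeModel_holds ψ (algebraMap K _ c) = algebraMap K _ c := fun c =>
    AbelianVariety.rosati_eq_self_of_mem_center hHD hI ψ hA4 (Subalgebra.mem_center_iff.2 fun z => (Algebra.commutes c z).symm)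
  -- `H¹B` as a `K`-vector space
  let f : K →+* Module.End ℚ (bettiCohomology B.X 1) :=
    { toFun := fun c => ρ (algebraMap K _ c)
      map_one' := by rw [map_one, hρone]
      map_mul' := fun c c' => by rw [mul_comm c c', map_mul, hρmul]
      map_zero' := by rw [map_zero, hρzero]
      map_add' := fun c c' => by rw [map_add, hρadd] }
  letI : Module K (bettiCohomology B.X 1) := Module.compHom _ f
  have hsmulK : ∀ (c : K) (x : bettiCohomology B.X 1), c • x = ρ (algebraMap K _ c) x := fun c x => rfl
  haveI : IsScalarTower ℚ K (bettiCohomology B.X 1) := ⟨fun q c x => by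
    rw [hsmulK, hsmulK, Algebra.smul_def, map_mul, ← IsScalarTower.algebraMap_apply ℚ K B.endAlgebra q, hρmul, hρrat,
      Module.End.mul_apply, LinearMap.smul_apply, Module.End.one_apply, map_smul]⟩
  haveI : Module.Finite K (bettiCohomology B.X 1) := Module.Finite.of_restrictScalars_finite ℚ K _
  -- `ψ` is `K`-balanced (Rosati fixes the centre) and descends along the trace
  have hbal : ∀ (c : K) (x y : bettiCohomology B.X 1), ψ.form (c • x) y = ψ.form x (c • y) := fun c x y => by
    rw [hsmulK, hsmulK, ← ψ.form_apply_adjoint (ρ (algebraMap K _ c)) x y, hτρ, hrosK]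
  obtain ⟨ψK, hψK⟩ := TraceFormDescent.exists_forall_trace_mul_eq (k := ℚ) ψ.form hbal
  have hψanti : ∀ x y : bettiCohomology B.X 1, ψ.form y x = -ψ.form x y := fun x y => by
    have h := LinearMap.congr_fun₂ ψ.flip_form x y
    rw [show (((1 : ℕ) : ℤ).negOnePow : ℤˣ) = -1 from Int.negOnePow_one, Units.val_neg, Units.val_one, neg_one_zsmul] at h
    simpa only [LinearMap.BilinForm.flip_apply, LinearMap.neg_apply] using h
  have hψKanti : ∀ x y, ψK y x = -ψK x y := (TraceFormDescent.flip_eq_neg_iff_of_trace hψK hbal).1 hψanti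
  have hψKflip : ψK.flip = -ψK := LinearMap.ext fun x => LinearMap.ext fun y => by
    rw [LinearMap.BilinForm.flip_apply, LinearMap.neg_apply, LinearMap.neg_apply, hψKanti]
  have hψKL : ∀ x, (∀ y, ψK x y = 0) → x = 0 := TraceFormDescent.separatingLeft_of_trace hψK ψ.nondegenerate.1
  have hψKnd : ψK.Nondegenerate := ⟨hψKL, fun y hy => hψKL y fun x => by rw [hψKanti, hy x, neg_zero]⟩
  -- elements of `End⁰B` act `K`-linearly: `ρK z`
  have hρK : ∀ z : B.endAlgebra, ∃ T : bettiCohomology B.X 1 →ₗ[K] bettiCohomology B.X 1, ∀ x, T x = ρ z x := fun z =>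
    ⟨{ toFun := ρ z, map_add' := map_add (ρ z), map_smul' := fun c x => by
        rw [RingHom.id_apply, hsmulK, hsmulK, ← Module.End.mul_apply, ← hcenK, Module.End.mul_apply] }, fun x => rfl⟩
  obtain ⟨iK, hiK⟩ := hρK u
  obtain ⟨jK, hjK⟩ := hρK v
  have hiK2 : iK * iK = algebraMap K _ a := LinearMap.ext fun x => by
    rw [Module.End.mul_apply, hiK, hiK, ← Module.End.mul_apply, ← hρmul, hu, Module.algebraMap_end_apply, hsmulK]
  have hjK2 : jK * jK = algebraMap K _ b := LinearMap.ext fun x => by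
    rw [Module.End.mul_apply, hjK, hjK, ← Module.End.mul_apply, ← hρmul, hv, Module.algebraMap_end_apply, hsmulK]
  have hijK : iK * jK = -(jK * iK) := LinearMap.ext fun x => by
    rw [Module.End.mul_apply, LinearMap.neg_apply, Module.End.mul_apply, hiK, hjK, hjK, hiK, ← Module.End.mul_apply,
      ← Module.End.mul_apply (ρ v), ← hρmul, ← hρmul, huv, hρneg, LinearMap.neg_apply, neg_neg]
  -- adjoints over `K`: `ψ_K(ρ(z) x, y) = ψ_K(x, ρ(z^ros) y)` (transfer along the trace)
  have hpair : ∀ (z : B.endAlgebra) (T : bettiCohomology B.X 1 →ₗ[K] bettiCohomology B.X 1), (∀ x, T x = ρ z x) →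
      ∀ x y, ψK (T x) y = ψK x ((ρ (AbelianVariety.rosati B exists_isReal_hodgeModel_holds hodgePQ_independent_of_hodgeModel_holds ψ z)) y) := by
    intro z T hT
    obtain ⟨S, hS⟩ := hρK (AbelianVariety.rosati B exists_isReal_hodgeModel_holds hodgePQ_independent_of_hodgeModel_holds ψ z)
    have h := (TraceFormDescent.isAdjointPair_iff_of_trace hψK T S).1 fun x y => by
      have e1 := ψ.form_apply_adjoint (ρ z) x y
      rw [hτρ] at e1
      rw [hT, hS]
      exact e1.symm
    intro x y
    rw [h, hS]
  have hiKskew : ψK.IsSkewAdjoint iK := fun x y => by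
    rw [Pi.neg_apply, hpair u iK hiK x y, hru, hρneg, LinearMap.neg_apply, hiK, map_neg]
  -- every element of `Lie Hg` is `K`-linear, commutes with `i, j` and is `ψ_K`-skew
  obtain ⟨MK, hMK⟩ : ∃ MK : Submodule K (bettiCohomology B.X 1 →ₗ[K] bettiCohomology B.X 1), MK =
      Subalgebra.toSubmodule (Subalgebra.centralizer K ({iK, jK} : Set (bettiCohomology B.X 1 →ₗ[K] bettiCohomology B.X 1))) ⊓
        ψK.skewAdjointSubmodule := ⟨_, rfl⟩
  have hlift : ∀ Y ∈ (BettiUniverse.hodge exists_isReal_hodgeModel_holds (AbelianVariety.isSmoothProjective_holds (A := B)) 1).hodgeLie,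
      ∃ T : bettiCohomology B.X 1 →ₗ[K] bettiCohomology B.X 1, (∀ x, T x = Y x) ∧ T ∈ MK := by
    intro Y hY
    obtain ⟨T, hT⟩ : ∃ T : bettiCohomology B.X 1 →ₗ[K] bettiCohomology B.X 1, ∀ x, T x = Y x :=
      ⟨{ toFun := Y, map_add' := map_add Y, map_smul' := fun c x => by
          rw [RingHom.id_apply, hsmulK, hsmulK, ← Module.End.mul_apply, hcomm_hodge hY, Module.End.mul_apply] }, fun x => rfl⟩
    refine ⟨T, hT, ?_⟩
    rw [hMK]
    refine Submodule.mem_inf.2 ⟨?_, ?_⟩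
    · rw [Subalgebra.mem_toSubmodule, Subalgebra.mem_centralizer_iff]
      intro g hg
      simp only [Set.mem_insert_iff, Set.mem_singleton_iff] at hg
      rcases hg with rfl | rfl
      · refine LinearMap.ext fun x => ?_
        rw [Module.End.mul_apply, Module.End.mul_apply, hT, hiK, hiK, hT, ← Module.End.mul_apply, ← hcomm_hodge hY u,
          Module.End.mul_apply]
      · refine LinearMap.ext fun x => ?_
        rw [Module.End.mul_apply, Module.End.mul_apply, hT, hjK, hjK, hT, ← Module.End.mul_apply, ← hcomm_hodge hY v,
          Module.End.mul_apply]
    · rw [LinearMap.mem_skewAdjointSubmodule]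
      have h := (TraceFormDescent.isAdjointPair_iff_of_trace hψK T (-T)).1 fun x y => by
        rw [hT, LinearMap.neg_apply, hT, map_neg]
        exact eq_neg_of_add_eq_zero_left (form_apply_add_eq_zero_of_mem_hodgeLie ψ hY x y)
      intro x y
      rw [Pi.neg_apply, h x y, LinearMap.neg_apply]
  -- the `ℚ`-linear embedding `Lie Hg ↪ M_K`
  choose T hT hTmem using hlift
  let Φ : (BettiUniverse.hodge exists_isReal_hodgeModel_holds (AbelianVariety.isSmoothProjective_holds (A := B)) 1).hodgeLie →ₗ[ℚ] MK :=
    { toFun := fun Y => ⟨T Y Y.2, hTmem Y Y.2⟩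
      map_add' := fun Y Y' => Subtype.ext (LinearMap.ext fun x => by
        change T _ (Y + Y').2 x = T Y Y.2 x + T Y' Y'.2 x
        rw [hT, hT, hT]
        rfl)
      map_smul' := fun r Y => Subtype.ext (LinearMap.ext fun x => by
        change T _ (r • Y).2 x = r • T Y Y.2 x
        rw [hT, hT]
        rfl) }
  have hΦ : Function.Injective Φ := by
    intro Y Y' h
    apply Subtype.ext
    refine LinearMap.ext fun x => ?_
    have h' : T Y Y.2 = T Y' Y'.2 := congrArg Subtype.val h
    rw [← hT Y Y.2, ← hT Y' Y'.2, h']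
  haveI : Module.Finite K MK := inferInstance
  haveI : Module.Finite ℚ MK := Module.Finite.trans K MK
  have hle := LinearMap.finrank_le_finrank_of_injective hΦ
  have hMKq : Module.finrank ℚ MK = Module.finrank ℚ K * Module.finrank K MK := (Module.finrank_mul_finrank ℚ K MK).symm
  have hn : Module.finrank ℚ K * Module.finrank K (bettiCohomology B.X 1) = Module.finrank ℚ (bettiCohomology B.X 1) :=
    Module.finrank_mul_finrank ℚ K (bettiCohomology B.X 1)
  refine ⟨Module.finrank K (bettiCohomology B.X 1), Module.finrank K MK, hn, by rw [← hMKq]; exact hle, fun hrv => ?_,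
    fun hrv => ?_⟩
  · -- type III: `j` is `ψ_K`-skew
    have hjKskew : ψK.IsSkewAdjoint jK := fun x y => by
      rw [Pi.neg_apply, hpair v jK hjK x y, hrv, hρneg, LinearMap.neg_apply, hjK, map_neg]
    have hcount := QuaternionCentralizerForm.eight_mul_finrank_centralizer_inf_skewAdjoint_add ψK hψKnd hψKflip ha hb hiK2
      hjK2 hijK hiKskew hjKskew
    rw [← hMK] at hcount
    exact hcount
  · -- type II: `j` is `ψ_K`-symmetric
    have hjKsymm : LinearMap.IsAdjointPair ψK ψK jK jK := fun x y => by
      rw [hpair v jK hjK x y, hrv, hjK]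
    have hcount := QuaternionCentralizerForm.eight_mul_finrank_centralizer_inf_skewAdjoint_orth ψK hψKnd hψKflip ha hb hiK2
      hjK2 hijK hiKskew hjKsymm
    rw [← hMK] at hcount
    exact hcount

/-! ## §2 Type III(e): `dim Lie Hg(H¹B) ≤ e · m(2m−1)` -/

/-- **The Lefschetz bound, type III over a totally real centre:** for a simple complex abelian variety `B` whose endomorphism
algebra is a TOTALLY DEFINITE quaternion algebra over a totally real number field `K` of degree `e`, with `dim B = 2em`:
**`dim Lie Hg(H¹B) ≤ e · m(2m−1)`** — Milne's `dim S(A) = g²/2f − g/2` (`f = e`, `g = 2em`).  The Rosati involution is the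
canonical involution (Lange Thm. 2.6.5 (c), the tree's `isPositiveAntiInvolution_iff_of_isOfFirstKind` over `K`), so a quaternion
basis `i, j` of `End⁰B ≅ (a, b / K)` is a Rosati pair `i† = -i`, `j† = -j`, and §1 applies.
[cite: Milne1999LefschetzClasses, §2 (type III) and Summary] [cite: Lange2023AbelianVarietiesComplex, §2.6.2 Thm. 2.6.5 (c)]
[cite: MoonenZarhin1999LowDim, §1] -/
theorem finrank_hodgeLie_hodge_one_le_of_isTotallyDefinite_centre {B : AbelianVariety ℂ} {k : ℕ} (hB : IsSmoothProjective k B.X)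
    (hBs : B.IsSimple) {K : Type} [Field K] [NumberField K] [IsTotallyReal K] [Algebra K B.endAlgebra]
    [IsScalarTower ℚ K B.endAlgebra] [IsQuaternionAlgebra K B.endAlgebra] (hdef : IsTotallyDefinite K B.endAlgebra) {m : ℕ}
    (hBm : B.dim = 2 * m * Module.finrank ℚ K) :
    haveI := BettiUniverse.finite hB 1
    Module.finrank ℚ (BettiUniverse.hodge exists_isReal_hodgeModel_holds hB 1).hodgeLie ≤ Module.finrank ℚ K * (m * (2 * m - 1)) := by
  classical
  have hk : B.dim = k := schemeDim_eq_holds hB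
  subst hk
  haveI := BettiUniverse.finite hB 1
  obtain ⟨ψ⟩ := BettiUniverse.hodge_isPolarizable exists_isReal_hodgeModel_holds hB 1
  -- the Rosati involution is the canonical involution of the definite quaternion algebra `End⁰B` over `K`
  have hD : ∀ x : B.endAlgebra, x ≠ 0 → IsUnit x := fun x hx => (isUnit_or_eq_zero_of_isSimple hBs x).resolve_right hx
  have hA4 : HasNoTypeIVFactor B := AbelianVariety.hasNoTypeIVFactor_of_isTotallyReal (K := K)
  have hpos := AbelianVariety.isPositiveAntiInvolution_rosati (A := B) exists_isReal_hodgeModel_holds hodgePQ_independent_of_hodgeModel_holds ψ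
  have h1 := AbelianVariety.isOfFirstKind_rosati (A := B) exists_isReal_hodgeModel_holds hodgePQ_independent_of_hodgeModel_holds ψ hA4 (K := K)
  have hros : ∀ x, AbelianVariety.rosati B exists_isReal_hodgeModel_holds hodgePQ_independent_of_hodgeModel_holds ψ x = standardInvolution K B.endAlgebra x := by
    obtain ⟨-, h⟩ := (isPositiveAntiInvolution_iff_of_isOfFirstKind K hD h1).mp hpos
    rcases h with ⟨-, h⟩ | ⟨hind, -⟩
    · exact h
    · obtain ⟨w⟩ : Nonempty (InfinitePlace K) := inferInstance
      exact absurd (hind.isSplitAtInfinite w) (hdef w)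
  obtain ⟨a, b, ha, hb, -, ⟨e⟩⟩ := exists_algEquiv_quaternionAlgebra_totallyNeg_of_isTotallyDefinite K B.endAlgebra hdef
  set q := (QuaternionAlgebra.Basis.self K).compHom (e.symm : ℍ[K,a,b] →ₐ[K] B.endAlgebra) with hq
  have hqi : q.i = e.symm ⟨0, 1, 0, 0⟩ := rfl
  have hqj : q.j = e.symm ⟨0, 0, 1, 0⟩ := rfl
  have hstar_i : standardInvolution K B.endAlgebra q.i = -q.i := by
    rw [hqi, standardInvolution_algEquiv, standardInvolution_quaternionAlgebra, ← map_neg]; congr 1; ext <;> simp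
  have hstar_j : standardInvolution K B.endAlgebra q.j = -q.j := by
    rw [hqj, standardInvolution_algEquiv, standardInvolution_quaternionAlgebra, ← map_neg]; congr 1; ext <;> simp
  have hu : q.i * q.i = algebraMap K B.endAlgebra a := by rw [q.i_mul_i, zero_smul, add_zero, Algebra.algebraMap_eq_smul_one]
  have hv : q.j * q.j = algebraMap K B.endAlgebra b := by rw [q.j_mul_j, Algebra.algebraMap_eq_smul_one]
  have huv : q.i * q.j = -(q.j * q.i) := by rw [q.j_mul_i, q.i_mul_j, zero_smul, zero_sub, neg_neg]
  have hru : AbelianVariety.rosati B exists_isReal_hodgeModel_holds hodgePQ_independent_of_hodgeModel_holds ψ q.i = -q.i := by rw [hros, hstar_i]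
  have hrv : AbelianVariety.rosati B exists_isReal_hodgeModel_holds hodgePQ_independent_of_hodgeModel_holds ψ q.j = -q.j := by rw [hros, hstar_j]
  obtain ⟨n, M, hn, hle, h3, -⟩ := exists_finrank_hodgeLie_le_of_centre_pair (B := B) ψ ha hb hu hv huv hru
  have hcount := h3 hrv
  have hdimV : Module.finrank ℚ (bettiCohomology B.X 1) = 4 * m * Module.finrank ℚ K := by
    rw [finrank_bettiCohomology_one_eq_two_mul_dim B, hBm]; ring
  have he : 0 < Module.finrank ℚ K := Module.finrank_pos
  have hn4 : n = 4 * m := by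
    have h' : Module.finrank ℚ K * n = Module.finrank ℚ K * (4 * m) := by rw [hn, hdimV]; ring
    exact Nat.eq_of_mul_eq_mul_left he h'
  subst hn4
  set p := m * m with hp
  have h16 : 4 * m * (4 * m) = 16 * p := by rw [hp]; ring
  rw [h16] at hcount
  have hM : M = 2 * p - m := by omega
  have hgoal : m * (2 * m - 1) = 2 * p - m := by rw [Nat.mul_sub_one, hp]; ring_nf
  rw [hgoal, ← hM]
  exact hle

/-- **`dim MT(H¹B) ≤ e · m(2m−1) + 1`** for `B` simple with totally definite quaternion multiplication over a totally real `K` of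
degree `e`, `dim B = 2em > 0`. [cite: Milne1999LefschetzClasses, §2 (type III) and Summary] [cite: MoonenZarhin1999LowDim, §1] -/
theorem mtRank_hodge_one_le_of_isTotallyDefinite_centre {B : AbelianVariety ℂ} {k : ℕ} (hB : IsSmoothProjective k B.X)
    (hBs : B.IsSimple) {K : Type} [Field K] [NumberField K] [IsTotallyReal K] [Algebra K B.endAlgebra]
    [IsScalarTower ℚ K B.endAlgebra] [IsQuaternionAlgebra K B.endAlgebra] (hdef : IsTotallyDefinite K B.endAlgebra) {m : ℕ}
    (hm : 0 < m) (hBm : B.dim = 2 * m * Module.finrank ℚ K) :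
    haveI := BettiUniverse.finite hB 1
    (BettiUniverse.hodge exists_isReal_hodgeModel_holds hB 1).mtRank ≤ Module.finrank ℚ K * (m * (2 * m - 1)) + 1 := by
  haveI := BettiUniverse.finite hB 1
  have h0 : 0 < B.dim := by rw [hBm]; exact Nat.mul_pos (Nat.mul_pos two_pos hm) Module.finrank_pos
  have h := finrank_hodgeLie_hodge_one_le_of_isTotallyDefinite_centre hB hBs hdef hBm
  rw [mtRank_hodge_one_eq_finrank_hodgeLie_add_one hB h0]
  omega

/-! ## §3 Type II(e): `dim Lie Hg(H¹B) ≤ e · m(2m+1)` -/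

/-- **The Lefschetz bound, type II over a totally real centre:** for a simple complex abelian variety `B` whose endomorphism
algebra is a TOTALLY INDEFINITE quaternion algebra over a totally real number field `K` of degree `e`, with `dim B = 2em`:
**`dim Lie Hg(H¹B) ≤ e · m(2m+1)`** — Milne's `dim S(A) = g²/2f + g/2`.  The Rosati involution is `x ↦ u⁻¹x̄u` with `u² = α`
totally negative (Lange Thm. 2.6.5 (b)); in a quaternionic basis through `u` (the tree's `exists_algEquiv_quaternionAlgebra_apply_eq`
over `K`) `i = u` is Rosati-skew and `j` Rosati-symmetric, and §1 applies. [cite: Milne1999LefschetzClasses, §2 (type II) and Summary]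
[cite: Lange2023AbelianVarietiesComplex, §2.6.2 Thm. 2.6.5 (b)] [cite: MoonenZarhin1999LowDim, §1] -/
theorem finrank_hodgeLie_hodge_one_le_of_isTotallyIndefinite_centre {B : AbelianVariety ℂ} {k : ℕ} (hB : IsSmoothProjective k B.X)
    (hBs : B.IsSimple) {K : Type} [Field K] [NumberField K] [IsTotallyReal K] [Algebra K B.endAlgebra]
    [IsScalarTower ℚ K B.endAlgebra] [IsQuaternionAlgebra K B.endAlgebra]
    (hind : Literature.RingTheory.CentralSimple.IsTotallyIndefinite K B.endAlgebra) {m : ℕ}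
    (hBm : B.dim = 2 * m * Module.finrank ℚ K) :
    haveI := BettiUniverse.finite hB 1
    Module.finrank ℚ (BettiUniverse.hodge exists_isReal_hodgeModel_holds hB 1).hodgeLie ≤ Module.finrank ℚ K * (m * (2 * m + 1)) := by
  classical
  have hk : B.dim = k := schemeDim_eq_holds hB
  subst hk
  haveI := BettiUniverse.finite hB 1
  obtain ⟨ψ⟩ := BettiUniverse.hodge_isPolarizable exists_isReal_hodgeModel_holds hB 1
  -- the Rosati involution is `x ↦ w₀⁻¹ x̄ w₀`, `w₀² = α` totally negative
  have hD : ∀ x : B.endAlgebra, x ≠ 0 → IsUnit x := fun x hx => (isUnit_or_eq_zero_of_isSimple hBs x).resolve_right hx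
  have hA4 : HasNoTypeIVFactor B := AbelianVariety.hasNoTypeIVFactor_of_isTotallyReal (K := K)
  have hpos := AbelianVariety.isPositiveAntiInvolution_rosati (A := B) exists_isReal_hodgeModel_holds hodgePQ_independent_of_hodgeModel_holds ψ
  have h1 := AbelianVariety.isOfFirstKind_rosati (A := B) exists_isReal_hodgeModel_holds hodgePQ_independent_of_hodgeModel_holds ψ hA4 (K := K)
  obtain ⟨-, h⟩ := (isPositiveAntiInvolution_iff_of_isOfFirstKind K hD h1).mp hpos
  obtain ⟨w₀, α, hww, hαneg, hros⟩ : ∃ (w₀ : (B.endAlgebra)ˣ) (α : K), (w₀ : B.endAlgebra) * w₀ = algebraMap K _ α ∧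
      (∀ σ : K →+* ℝ, σ α < 0) ∧
      ∀ x, AbelianVariety.rosati B exists_isReal_hodgeModel_holds hodgePQ_independent_of_hodgeModel_holds ψ x = ↑w₀⁻¹ * standardInvolution K B.endAlgebra x * w₀ := by
    rcases h with ⟨hdef, -⟩ | ⟨-, w₀, α, hww, hαneg, hros⟩
    · obtain ⟨w⟩ : Nonempty (InfinitePlace K) := inferInstance
      exact absurd (hind.isSplitAtInfinite w) (hdef w)
    · exact ⟨w₀, α, hww, hαneg, hros⟩
  -- `w₀ ∉ K`: `α` is totally negative, not a square
  haveI : Nontrivial B.endAlgebra :=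
    Module.nontrivial_of_finrank_pos (R := K) (by rw [IsQuaternionAlgebra.finrank_eq_four (K := K) (D := B.endAlgebra)]; norm_num)
  have hwbot : (w₀ : B.endAlgebra) ∉ (⊥ : Subalgebra K B.endAlgebra) := by
    rw [Algebra.mem_bot]
    rintro ⟨c, hc⟩
    have h2 : algebraMap K B.endAlgebra (c * c) = algebraMap K B.endAlgebra α := by rw [map_mul, hc, hww]
    have hcc : c * c = α := (algebraMap K B.endAlgebra).injective h2
    obtain ⟨w⟩ : Nonempty (InfinitePlace K) := inferInstance
    have hw : w.IsReal := IsTotallyReal.isReal w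
    have hσ := hαneg (InfinitePlace.embedding_of_isReal hw)
    rw [← hcc, map_mul] at hσ
    nlinarith [mul_self_nonneg (InfinitePlace.embedding_of_isReal hw c)]
  obtain ⟨β, hα0, hβ0, e, hew⟩ := exists_algEquiv_quaternionAlgebra_apply_eq K hD hwbot hww
  set q := (QuaternionAlgebra.Basis.self K).compHom (e.symm : ℍ[K,α,β] →ₐ[K] B.endAlgebra) with hq
  have hqi : q.i = w₀ := by change e.symm ⟨0, 1, 0, 0⟩ = w₀; rw [← hew, AlgEquiv.symm_apply_apply]
  have hqj : q.j = e.symm ⟨0, 0, 1, 0⟩ := rfl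
  have hstar_i : standardInvolution K B.endAlgebra q.i = -q.i := by
    rw [hqi, ← e.symm_apply_apply (w₀ : B.endAlgebra), hew, standardInvolution_algEquiv, standardInvolution_quaternionAlgebra,
      ← map_neg]; congr 1; ext <;> simp
  have hstar_j : standardInvolution K B.endAlgebra q.j = -q.j := by
    rw [hqj, standardInvolution_algEquiv, standardInvolution_quaternionAlgebra, ← map_neg]; congr 1; ext <;> simp
  have hji' : q.j * q.i = -(q.i * q.j) := by rw [q.j_mul_i, q.i_mul_j, zero_smul, zero_sub]
  have hu : q.i * q.i = algebraMap K B.endAlgebra α := by rw [q.i_mul_i, zero_smul, add_zero, Algebra.algebraMap_eq_smul_one]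
  have hv : q.j * q.j = algebraMap K B.endAlgebra β := by rw [q.j_mul_j, Algebra.algebraMap_eq_smul_one]
  have huv : q.i * q.j = -(q.j * q.i) := by rw [hji', neg_neg]
  have hru : AbelianVariety.rosati B exists_isReal_hodgeModel_holds hodgePQ_independent_of_hodgeModel_holds ψ q.i = -q.i := by
    rw [hros, hstar_i, hqi, mul_neg, neg_mul, Units.inv_mul, one_mul]
  have hrv : AbelianVariety.rosati B exists_isReal_hodgeModel_holds hodgePQ_independent_of_hodgeModel_holds ψ q.j = q.j := by
    rw [hros, hstar_j, mul_neg, neg_mul, mul_assoc, ← hqi, hji', mul_neg, ← mul_assoc, hqi, Units.inv_mul, one_mul, neg_neg]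
  obtain ⟨n, M, hn, hle, -, h2⟩ := exists_finrank_hodgeLie_le_of_centre_pair (B := B) ψ hα0 hβ0 hu hv huv hru
  have hcount := h2 hrv
  have hdimV : Module.finrank ℚ (bettiCohomology B.X 1) = 4 * m * Module.finrank ℚ K := by
    rw [finrank_bettiCohomology_one_eq_two_mul_dim B, hBm]; ring
  have he : 0 < Module.finrank ℚ K := Module.finrank_pos
  have hn4 : n = 4 * m := by
    have h' : Module.finrank ℚ K * n = Module.finrank ℚ K * (4 * m) := by rw [hn, hdimV]; ring
    exact Nat.eq_of_mul_eq_mul_left he h'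
  subst hn4
  set p := m * m with hp
  have h16 : 4 * m * (4 * m) = 16 * p := by rw [hp]; ring
  rw [h16] at hcount
  have hM : M = 2 * p + m := by omega
  have hgoal : m * (2 * m + 1) = 2 * p + m := by rw [hp]; ring
  rw [hgoal, ← hM]
  exact hle

/-- **`dim MT(H¹B) ≤ e · m(2m+1) + 1`** for `B` simple with totally indefinite quaternion multiplication over a totally real `K` of
degree `e`, `dim B = 2em > 0`. [cite: Milne1999LefschetzClasses, §2 (type II) and Summary] [cite: MoonenZarhin1999LowDim, §1] -/
theorem mtRank_hodge_one_le_of_isTotallyIndefinite_centre {B : AbelianVariety ℂ} {k : ℕ} (hB : IsSmoothProjective k B.X)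
    (hBs : B.IsSimple) {K : Type} [Field K] [NumberField K] [IsTotallyReal K] [Algebra K B.endAlgebra]
    [IsScalarTower ℚ K B.endAlgebra] [IsQuaternionAlgebra K B.endAlgebra]
    (hind : Literature.RingTheory.CentralSimple.IsTotallyIndefinite K B.endAlgebra) {m : ℕ} (hm : 0 < m)
    (hBm : B.dim = 2 * m * Module.finrank ℚ K) :
    haveI := BettiUniverse.finite hB 1
    (BettiUniverse.hodge exists_isReal_hodgeModel_holds hB 1).mtRank ≤ Module.finrank ℚ K * (m * (2 * m + 1)) + 1 := by
  haveI := BettiUniverse.finite hB 1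
  have h0 : 0 < B.dim := by rw [hBm]; exact Nat.mul_pos (Nat.mul_pos two_pos hm) Module.finrank_pos
  have h := finrank_hodgeLie_hodge_one_le_of_isTotallyIndefinite_centre hB hBs hind hBm
  rw [mtRank_hodge_one_eq_finrank_hodgeLie_add_one hB h0]
  omega

end Summit.HodgeConjecture.CorCM

end
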